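import Summits.QuantumFields.YangMills.Theorems.UnitScaleTiltProp7EMLTowerCentral
import Summits.QuantumFields.YangMills.Theorems.UnitScaleTiltProp7SymAvgTwSymDefs
import Summits.QuantumFields.YangMills.Theorems.UnitScaleTiltProp8ChartDoubleBarAbelian
import HarnessLib

/-!
# Route `UnitScaleTilt`, crux K1 child «MinimiserStabilityRegPr» (stmt-QuantumFields-19200), stub `stub_existenceMinimalOrbit` (EX), the (R) reality rows of the EX knit —
# **(Q-b): PRINT'S AVERAGING OPERATOR `Q(U₀) = QTwS U₀` ON THE SCALAR SECTOR `ℂ·1`** (ym-inputs-p03 g2 memo #51 `REALITY-ROWS-LOCATE-p03g2.md` §3): at EVERY background whose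
# (0.4) loop variables are small at every level (a printed-regular background), `QTwS U₀` maps the scalar bond field `c(b)·1` to the scalar block field
# `(L^{K−n}·(Q_{K−n} c)(ĉ))·1` — the flat linear multi-level average of print, i.e. ITS VALUE AT `U₀ = 1` ((J2) ✓`QTwS_one_apply`) — because the re-based twisted chart of a
# CENTRAL perturbation `e^{iz(b)}·1` is the abelian double-bar tower of `e^{iz}` read in the centre (✓`…EMLTowerCentral` + ★w8-19200's ✓`Prop8ChartDoubleBarAbelian`).

Cell `ym3-torus`, width seat `ym-ust-20520-w5` (gen 5).  `--supports stmt-QuantumFields-19200 --as helper`; THEOREMS ONLY (0 `def`, 0 `sorry`); count-neutral; nothing here claims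
the stub, the crux, d = 4 or the mass gap — YM₃ on T³ is a ladder rung (R3), not the Clay problem.

WHY (memo #51 §2–§3).  p01's Hilbert carriers are `W₂ ≅ M₂(ℂ) = 𝔰𝔩(2,ℂ) ⊕ ℂ·1`-valued; the reality of `Q† = Qk†` and of everything downstream (`H = GQ†(QGQ†)⁻¹`, `H₁`, `𝔓`, `𝔊`,
`Δ_a`, `R_S`) needs `Q∘σ = σ∘Q` on ALL of `E` and `Q(scalar) ⊆ scalar`; (Q-a) (✓`logChartTwS_skewHermitian_of_regPr₂` ⇒ `𝔰𝔲(2) → 𝔰𝔲(2)`) covers `𝔰𝔩(2,ℂ)`, this file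
covers the centre: `Q(c·1) = ℓ(c)·1` with `ℓ` the REAL-coefficient flat average, whence both properties on `ℂ·1` (`star_QTwS_smul_one_of_central`).

WHAT IS PROVED (`k := K − n`, `U₀♭ := bgUnits F K U₀`, `ĉ := bondShift (sites_eq F n K h) c`, `ι := algebraMap ℂ M₂(ℂ)`, `ιˣ := Units.map ι`):
* §1 `mlog_algebraMap` (`log (ι z) = ι (log z)`, `‖z − 1‖ < 1`), `expUnit_smul_one_mul` (the central perturbation `e^{(iz)·1}·U₀♭ = (ιˣ e^{iz})·U₀♭`, exact).
* §2 ★`dbarTwS_central` — `U̿^{twS}((iz)·1)(c) = ιˣ (U̿^{(k)}(e^{iz})(ĉ))` (the abelian tower of `e^{iz}` in the centre), under the DISPLAYED `1∕8`-smallness of the (0.4) loop variables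
  of every background iterate `Ū₀♭ʲ` (`j < k`; gauge-invariant) and of the scalar tower and its stairs; ★★`logChartTwS_central` — `log U̿^{twS}((iz)·1)(c) = (i·Lᵏ·(Q_k z)(ĉ))·1`
  when moreover `|z(b)| ≤ t`, `2ℓLᵏt ≤ 1` (✓`dbarIterU_coe_eq_exp_abelian` at `S = univ`).
* §3 ★★★`QTwS_apply_smul_one` — for `logChartTwS U₀` differentiable at `0` (✓`hasFDerivAt_logChartTwS` in the regime) and the identity of §2 holding for the perturbations
  `(t·c)·1`, `t` near `0` (displayed as an `∃ δ` clause on the scalar tower of `e^{t c}` — the background clause is `t`-free):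
  `QTwS F n K h U₀ (fun b => c b • 1) = fun B => ((L : ℂ)^k · (bondAvgIter k c)(B̂)) • 1`; corollaries (from that identity, displayed as `hc`) `QTwS_smul_one_eq_QTwS_one_of_central`
  ((J2): the value at `U₀ = 1`, ✓`QTwS_one_apply`) and `star_QTwS_smul_one_of_central` (`Q(σ(c·1)) = σ(Q(c·1))`: the flat average has REAL coefficients — `σ = star`, the
  linear-map bookkeeping ✓`ChartHInv.bondAvgIter_comp_apply` at complex conjugation).
HONEST SCOPE.  Composition of landed identities; the `∃ δ` clause of §3 (the scalar tower of `e^{tc}` is `1∕8`-small for small `t`) and the background loop clause (⟸ `RegPr` by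
plaquette smallness and [Balaban1985Averaging] Prop. 2) are DISPLAYED here; nothing of [Balaban1985Averaging]∕[Balaban1985BackgroundPropagators] is asserted.

References: T. Bałaban, CMP **98** (1985) 17–51 [Balaban1985Averaging] ((82) p.30, (89)–(92) p.31, (125)–(127) p.36, Prop. 4 (134)–(135) p.38); CMP **96** (1984) 223–250
[Balaban1985BackgroundPropagators] ((3.13)–(3.15) p.393); CMP **95** (1984) 17–40 [Balaban1984PropagatorsI] ((1.18) p.20); CMP **102** (1985) 277–309 [Balaban1985Variational] ((44) p.285).
-/

set_option autoImplicit false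

noncomputable section

open scoped Matrix.Norms.L2Operator
open Filter Topology

namespace Summit.QuantumFields.YangMills.Theorems.Prop7SymAvgTwSym

open NormedSpace
open Literature.MathematicalPhysics.QuantumFieldTheory.Balaban1983to89
open T4Continuum BlockAveraging ExpMeanLog MatrixLog LatticeFieldCalculus
open B7BlockAvgLog (mlog_exp)
open Literature.Analysis.Complex (logSeriesCoeff)
open B10Eq27TorusAxialLog (holT gaugeActT gaugeActT_apply)
open B7Prop1Explicit (expUnit val_expUnit)
open T3ContinuumYM3Torus
open T3LevelShift (siteShift bondShift bondShift_tgt fieldShift)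
open T3PrintedRegularOrbits (sites_eq)
open T3SectALandauChart (bgUnits bgUnits_one)
open Summit.QuantumFields.YangMills.Theorems.Prop8Chart (loopHolU emlAvgU emlIterU emlIterU_succ emlIterU_zero expCfg coe_expCfg expCfg_zero)
open Summit.QuantumFields.YangMills.Theorems.Prop8ChartDoubleBar (vframeU dbarAvgU dbarIterU dbarIterU_succ dbarIterU_zero dbarIterU_coe_eq_exp_abelian bondAvgIter_const_mul)
open Literature.MathematicalPhysics.QuantumFieldTheory.BalabanImbrieJaffe1984to88.BIJ85ContourLocality (norm_bondAvgIter_le_tower)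

/-! ## §1 Two pieces of bookkeeping: the series logarithm of a central element; the central perturbation in units -/

section Book

variable {𝔸 : Type*} [NormedRing 𝔸] [NormOneClass 𝔸] [NormedAlgebra ℂ 𝔸] [CompleteSpace 𝔸]

/-- `log (ι z) = ι (log z)` for `‖z − 1‖ < 1`: the series (21) commutes with the continuous unital embedding of the centre termwise. [cite: Balaban1985Averaging, (21) p.22] -/
theorem mlog_algebraMap {z : ℂ} (hz : ‖z - 1‖ < 1) : mlog (algebraMap ℂ 𝔸 z) = algebraMap ℂ 𝔸 (mlog z) := by
  have h1 := hasSum_mlog hz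
  have h2 : HasSum (fun n : ℕ => logSeriesCoeff n • (algebraMap ℂ 𝔸 z - 1) ^ n) (algebraMap ℂ 𝔸 (mlog z)) := by
    have h3 := h1.mapL (Algebra.linearMap ℂ 𝔸).toContinuousLinearMap
    simp only [LinearMap.coe_toContinuousLinearMap', Algebra.linearMap_apply, map_smul, map_pow, map_sub, map_one] at h3
    exact h3
  have h4 : ‖algebraMap ℂ 𝔸 z - 1‖ < 1 := by rw [norm_algebraMap_sub_one]; exact hz
  exact (hasSum_mlog h4).unique h2

omit [NormOneClass 𝔸] in
/-- **THE CENTRAL PERTURBATION IN UNITS**: `e^{(iz)·1}·u = (ιˣ e^{iz})·u` — the GL exponent `(iz(b))·1` of the symmetric chart is the scalar chart `expCfg 1 z` of the H side read in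
the centre. [cite: Balaban1985Variational, (19) p.281; Balaban1985Averaging, (8) p.19] -/
theorem expUnit_smul_one_mul {ι' : Type*} (z : ι' → ℂ) (U : ι' → 𝔸ˣ) :
    (fun b => expUnit ((Complex.I * z b) • (1 : 𝔸)) * U b) =
      fun b => Units.map ((algebraMap ℂ 𝔸 : ℂ →+* 𝔸) : ℂ →* 𝔸) (expUnit (Complex.I * z b)) * U b := by
  funext b
  congr 1
  apply Units.ext
  rw [val_expUnit, Units.coe_map, MonoidHom.coe_coe, val_expUnit, ← Algebra.algebraMap_eq_smul_one, algebraMap_exp_comm]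

omit [NormOneClass 𝔸] in
/-- at `𝔸 = ℂ`-level bookkeeping: the H side's `expCfg 1 z` IS the field `b ↦ e^{iz(b)}` in units. [cite: Balaban1985Variational, (152) p.301] -/
theorem expCfg_one_eq_expUnit {P : Params} (z : PBond P 0 → ℂ) : expCfg (𝔸 := ℂ) 1 z = fun b => expUnit (Complex.I * z b) := by
  funext b
  apply Units.ext
  rw [coe_expCfg, val_expUnit, Complex.ofReal_one, mul_one, smul_eq_mul]

end Book

/-! ## §2 The re-based twisted chart of a central perturbation is the abelian double-bar tower read in the centre -/

section T3

variable (F : T3Family) {n K : ℕ} (h : n ≤ K)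

/-- ★ **`U̿^{twS}((iz)·1)(c) = ιˣ (U̿^{(k)}(e^{iz})(ĉ))`** — the twisted symmetric double-bar tower (92) of the CENTRAL perturbation `e^{iz}·1` against ANY background `U₀` is the H side's
abelian double-bar tower of the scalar field `e^{iz}` (`𝔸 = ℂ`) read in the centre: the matrix parts cancel (frames exactly, averages through the `1∕8`-small loop variables).
Hypotheses DISPLAYED: the (0.4) loop variables of every background iterate `Ū₀♭ʲ`, `j < k` (gauge-invariant; plaquette smallness of a printed-regular `U₀`), and of the scalar tower of
`e^{iz}` and its stairs. [cite: Balaban1985Averaging, (89)-(92) p.31, (127) p.36; Balaban1984PropagatorsI, (1.18) p.20] -/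
theorem dbarTwS_central (U₀ : GaugeField (F.P K) 0 (Matrix.specialUnitaryGroup (Fin 2) ℂ)) (z : PBond (F.P K) 0 → ℂ)
    (hbg : ∀ j, j < K - n → ∀ (c : PBond (F.P K) (j + 1)) (i : Idx (F.P K)),
      ‖((loopHolU (emlIterU j (bgUnits F K U₀)) c i : (Matrix (Fin 2) (Fin 2) ℂ)ˣ) : Matrix (Fin 2) (Fin 2) ℂ) - 1‖ ≤ 1 / 8)
    (hsc : ∀ j, j < K - n → ∀ (c : PBond (F.P K) (j + 1)) (i : Idx (F.P K)),
      ‖((loopHolU (dbarIterU j (fun b => expUnit (Complex.I * z b))) c i : ℂˣ) : ℂ) - 1‖ ≤ 1 / 8)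
    (hst : ∀ j, j < K - n → ∀ (y : Site (F.P K) (j + 1)) (i : Idx (F.P K)),
      ‖((holT (dbarIterU j (fun b => expUnit (Complex.I * z b))) (emb y) (stairWord i.2.1 (off i.1)) : ℂˣ) : ℂ) - 1‖ < 1)
    (c : PBond (F.P n) 0) :
    dbarTwS F n K h U₀ (fun b => (Complex.I * z b) • (1 : Matrix (Fin 2) (Fin 2) ℂ)) c =
      Units.map ((algebraMap ℂ (Matrix (Fin 2) (Fin 2) ℂ) : ℂ →+* Matrix (Fin 2) (Fin 2) ℂ) : ℂ →* Matrix (Fin 2) (Fin 2) ℂ)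
        (dbarIterU (K - n) (fun b => expUnit (Complex.I * z b)) (bondShift (sites_eq F n K h) c)) := by
  rw [dbarTwS_eq_dbarCovIterU_mul_inv, expUnit_smul_one_mul,
    (dbarCovIterU_centralMul_self (fun b => expUnit (Complex.I * z b)) (bgUnits F K U₀) (K - n) hbg hsc hst).1, mul_inv_cancel_right]

/-- ★★ **`log U̿^{twS}((iz)·1)(c) = (i·Lᵏ·(Q_k z)(ĉ))·1`** — the re-based twisted log-chart of a central perturbation is print's FLAT linear multi-level average (1.18)∕(125) in the centre,
at every background with small loop variables, for `|z(b)| ≤ t`, `2ℓ·Lᵏ·t ≤ 1` (`ℓ = (d+2)L`; ✓`dbarIterU_coe_eq_exp_abelian` on the whole torus).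
[cite: Balaban1985Averaging, (125)-(127) p.36, Prop. 4 (134)-(135) p.38; Balaban1984PropagatorsI, (1.18) p.20] -/
theorem logChartTwS_central (U₀ : GaugeField (F.P K) 0 (Matrix.specialUnitaryGroup (Fin 2) ℂ)) (z : PBond (F.P K) 0 → ℂ) {t : ℝ} (ht0 : 0 ≤ t)
    (hsmall : 2 * ((((F.P K).d + 2) * (F.P K).L : ℕ) : ℝ) * (((F.P K).L : ℝ) ^ (K - n) * t) ≤ 1) (hz : ∀ b, ‖z b‖ ≤ t)
    (hbg : ∀ j, j < K - n → ∀ (c : PBond (F.P K) (j + 1)) (i : Idx (F.P K)),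
      ‖((loopHolU (emlIterU j (bgUnits F K U₀)) c i : (Matrix (Fin 2) (Fin 2) ℂ)ˣ) : Matrix (Fin 2) (Fin 2) ℂ) - 1‖ ≤ 1 / 8)
    (hsc : ∀ j, j < K - n → ∀ (c : PBond (F.P K) (j + 1)) (i : Idx (F.P K)),
      ‖((loopHolU (dbarIterU j (fun b => expUnit (Complex.I * z b))) c i : ℂˣ) : ℂ) - 1‖ ≤ 1 / 8)
    (hst : ∀ j, j < K - n → ∀ (y : Site (F.P K) (j + 1)) (i : Idx (F.P K)),
      ‖((holT (dbarIterU j (fun b => expUnit (Complex.I * z b))) (emb y) (stairWord i.2.1 (off i.1)) : ℂˣ) : ℂ) - 1‖ < 1)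
    (c : PBond (F.P n) 0) :
    logChartTwS F n K h U₀ (fun b => (Complex.I * z b) • (1 : Matrix (Fin 2) (Fin 2) ℂ)) c =
      (Complex.I * ((((F.P K).L : ℂ)) ^ (K - n) * bondAvgIter (K - n) z (bondShift (sites_eq F n K h) c))) • (1 : Matrix (Fin 2) (Fin 2) ℂ) := by
  have hk : K - n ≤ (F.P K).m + (F.P K).K := by show K - n ≤ F.m + K; omega
  -- the abelian tower on the whole torus
  have hab := dbarIterU_coe_eq_exp_abelian (P := F.P K) (1 : ℝ) (K - n) hk Set.univ z t ht0 (by rwa [abs_one, one_mul])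
    (fun b _ _ => hz b) (bondShift (sites_eq F n K h) c) (Set.mem_univ _) (Set.mem_univ _)
  rw [expCfg_one_eq_expUnit, Complex.ofReal_one, mul_one] at hab
  -- the exponent is `< log 2`
  set w : ℂ := Complex.I * ((((F.P K).L : ℂ)) ^ (K - n) * bondAvgIter (K - n) z (bondShift (sites_eq F n K h) c)) with hw
  have hℓ : (2 : ℝ) ≤ ((((F.P K).d + 2) * (F.P K).L : ℕ) : ℝ) := by
    have h1 : 1 ≤ (F.P K).L := (F.P K).L_pos
    have h2 : 2 ≤ ((F.P K).d + 2) * (F.P K).L := by nlinarith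
    exact_mod_cast h2
  have hQ : ‖bondAvgIter (K - n) z (bondShift (sites_eq F n K h) c)‖ ≤ t :=
    norm_bondAvgIter_le_tower (K - n) hk Set.univ z t (fun b _ _ => hz b) _ (Set.mem_univ _) (Set.mem_univ _)
  have hwn : ‖w‖ ≤ 1 / 4 := by
    rw [hw, norm_mul, Complex.norm_I, one_mul, norm_mul, norm_pow, Complex.norm_natCast]
    have hLt : 0 ≤ ((F.P K).L : ℝ) ^ (K - n) * t := by positivity
    calc ((F.P K).L : ℝ) ^ (K - n) * ‖bondAvgIter (K - n) z (bondShift (sites_eq F n K h) c)‖ ≤ ((F.P K).L : ℝ) ^ (K - n) * t := by gcongr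
      _ ≤ 1 / 4 := by nlinarith
  have hlog2 := Real.log_two_gt_d9
  have hw2 : ‖w‖ < Real.log 2 := by linarith
  have hexp1 : ‖Complex.exp w - 1‖ < 1 := by
    have h1 : ‖Complex.exp w - 1‖ ≤ 2 * ‖w‖ := by
      have := Complex.norm_exp_sub_one_le (x := w) (by linarith)
      linarith [norm_nonneg w]
    linarith
  rw [logChartTwS_apply, dbarTwS_central F h U₀ z hbg hsc hst c, Units.coe_map, MonoidHom.coe_coe, hab, mlog_algebraMap hexp1, Complex.exp_eq_exp_ℂ, mlog_exp hw2,
    Algebra.algebraMap_eq_smul_one]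

end T3

/-! ## §3 The averaging operator on the scalar sector -/

section Scalar

variable (F : T3Family) {n K : ℕ} (h : n ≤ K)

/-- ★★★ **(Q-b) — `Q(U₀)` ON THE CENTRE IS THE FLAT AVERAGE**: for a background `U₀` whose (0.4) loop variables are `1∕8`-small at every level `< K − n` (a printed-regular background),
with `log U̿^{twS}` differentiable at `0` (✓`hasFDerivAt_logChartTwS` in the regime), and the scalar tower of `e^{tc}` `1∕8`-small for `t` near `0` (displayed `∃ δ` clause),
`Q(U₀)(c·1) = (L^{K−n}·(Q_{K−n} c)(ĉ))·1` — scalar-valued, with the REAL flat coefficients of (1.18)∕(125), independent of `U₀` (= its value at `U₀ = 1`, (J2) ✓`QTwS_one_apply`).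
[cite: Balaban1985BackgroundPropagators, (3.14)-(3.15) p.393; Balaban1985Averaging, (125)-(127) p.36; Balaban1984PropagatorsI, (1.18) p.20] -/
theorem QTwS_apply_smul_one (U₀ : GaugeField (F.P K) 0 (Matrix.specialUnitaryGroup (Fin 2) ℂ)) (c : PBond (F.P K) 0 → ℂ)
    (hd : DifferentiableAt ℂ (logChartTwS F n K h U₀) 0)
    (hbg : ∀ j, j < K - n → ∀ (e : PBond (F.P K) (j + 1)) (i : Idx (F.P K)),
      ‖((loopHolU (emlIterU j (bgUnits F K U₀)) e i : (Matrix (Fin 2) (Fin 2) ℂ)ˣ) : Matrix (Fin 2) (Fin 2) ℂ) - 1‖ ≤ 1 / 8)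
    (hδ : ∃ δ : ℝ, 0 < δ ∧ ∀ t : ℂ, ‖t‖ < δ →
      (∀ j, j < K - n → ∀ (e : PBond (F.P K) (j + 1)) (i : Idx (F.P K)),
        ‖((loopHolU (dbarIterU j (fun b => expUnit (t * c b))) e i : ℂˣ) : ℂ) - 1‖ ≤ 1 / 8) ∧
      (∀ j, j < K - n → ∀ (y : Site (F.P K) (j + 1)) (i : Idx (F.P K)),
        ‖((holT (dbarIterU j (fun b => expUnit (t * c b))) (emb y) (stairWord i.2.1 (off i.1)) : ℂˣ) : ℂ) - 1‖ < 1)) :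
    QTwS F n K h U₀ (fun b => c b • (1 : Matrix (Fin 2) (Fin 2) ℂ)) =
      fun B => ((((F.P K).L : ℂ)) ^ (K - n) * bondAvgIter (K - n) c (bondShift (sites_eq F n K h) B)) • (1 : Matrix (Fin 2) (Fin 2) ℂ) := by
  obtain ⟨δ, hδ0, hδ⟩ := hδ
  set V : PBond (F.P K) 0 → Matrix (Fin 2) (Fin 2) ℂ := fun b => c b • (1 : Matrix (Fin 2) (Fin 2) ℂ) with hV
  set Wv : PBond (F.P n) 0 → Matrix (Fin 2) (Fin 2) ℂ :=
    fun B => ((((F.P K).L : ℂ)) ^ (K - n) * bondAvgIter (K - n) c (bondShift (sites_eq F n K h) B)) • (1 : Matrix (Fin 2) (Fin 2) ℂ) with hWv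
  -- sizes: `M` bounds `c`, `ℓLᵏ` the abelian window
  set M : ℝ := ∑ b, ‖c b‖ with hM
  have hM0 : 0 ≤ M := Finset.sum_nonneg fun b _ => norm_nonneg (c b)
  have hcM : ∀ b, ‖c b‖ ≤ M := fun b => Finset.single_le_sum (f := fun b => ‖c b‖) (fun b _ => norm_nonneg (c b)) (Finset.mem_univ b)
  set ℓL : ℝ := 2 * ((((F.P K).d + 2) * (F.P K).L : ℕ) : ℝ) * ((F.P K).L : ℝ) ^ (K - n) with hℓL
  have hℓL0 : 0 < ℓL := by
    have h1 : 1 ≤ (F.P K).L := (F.P K).L_pos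
    have h2 : 1 ≤ ((F.P K).d + 2) * (F.P K).L := by nlinarith
    have h3 : (1 : ℝ) ≤ ((((F.P K).d + 2) * (F.P K).L : ℕ) : ℝ) := by exact_mod_cast h2
    positivity
  set δ₂ : ℝ := 1 / (ℓL * (M + 1)) with hδ₂
  have hδ₂0 : 0 < δ₂ := by positivity
  -- the chart is linear in `t` along the centre, near `t = 0`
  have key : ∀ᶠ t : ℂ in 𝓝 0, logChartTwS F n K h U₀ (t • V) = t • Wv := by
    have hball : Metric.ball (0 : ℂ) (min δ δ₂) ∈ 𝓝 (0 : ℂ) := Metric.ball_mem_nhds 0 (lt_min hδ0 hδ₂0)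
    filter_upwards [hball] with t ht
    rw [Metric.mem_ball, dist_zero_right] at ht
    have htδ : ‖t‖ < δ := ht.trans_le (min_le_left _ _)
    have htδ₂ : ‖t‖ < δ₂ := ht.trans_le (min_le_right _ _)
    obtain ⟨hsc, hst⟩ := hδ t htδ
    -- the central perturbation `(t c)·1 = (i z)·1`, `z = −i t c`
    set z : PBond (F.P K) 0 → ℂ := fun b => -Complex.I * t * c b with hz
    have hIz : ∀ b, Complex.I * z b = t * c b := fun b => by
      rw [hz]; ring_nf; rw [Complex.I_sq]; ring
    have htV : t • V = fun b => (Complex.I * z b) • (1 : Matrix (Fin 2) (Fin 2) ℂ) := by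
      funext b; rw [Pi.smul_apply, hV, smul_smul, hIz]
    have hexp : (fun b => expUnit (Complex.I * z b)) = fun b => expUnit (t * c b) := by
      funext b; rw [hIz]
    -- the abelian window at `τ := ‖t‖·M`
    have hzτ : ∀ b, ‖z b‖ ≤ ‖t‖ * M := fun b => by
      rw [hz, norm_mul, norm_mul, norm_neg, Complex.norm_I, one_mul]
      exact mul_le_mul_of_nonneg_left (hcM b) (norm_nonneg t)
    have hwin : 2 * ((((F.P K).d + 2) * (F.P K).L : ℕ) : ℝ) * (((F.P K).L : ℝ) ^ (K - n) * (‖t‖ * M)) ≤ 1 := by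
      have h1 : 2 * ((((F.P K).d + 2) * (F.P K).L : ℕ) : ℝ) * (((F.P K).L : ℝ) ^ (K - n) * (‖t‖ * M)) = ℓL * M * ‖t‖ := by rw [hℓL]; ring
      rw [h1]
      have h2 : ‖t‖ * (ℓL * (M + 1)) < 1 := by
        have := (lt_div_iff₀ (by positivity : (0 : ℝ) < ℓL * (M + 1))).mp (hδ₂ ▸ htδ₂)
        linarith
      nlinarith [norm_nonneg t, mul_nonneg hℓL0.le hM0]
    funext e
    rw [htV, logChartTwS_central F h U₀ z (by positivity) hwin hzτ hbg (by rw [hexp]; exact hsc) (by rw [hexp]; exact hst) e, Pi.smul_apply, hWv,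
      smul_smul]
    congr 1
    have hQ : bondAvgIter (K - n) z (bondShift (sites_eq F n K h) e) = (-Complex.I * t) * bondAvgIter (K - n) c (bondShift (sites_eq F n K h) e) := by
      rw [← bondAvgIter_const_mul]
    rw [hQ]; ring_nf; rw [Complex.I_sq]; ring
  -- the directional derivative along `V` of the differentiable chart is `Q(U₀) V`; along the line it is `Wv`
  have h1 : HasDerivAt (fun t : ℂ => logChartTwS F n K h U₀ (t • V)) (QTwS F n K h U₀ V) 0 := by
    have hf : HasFDerivAt (logChartTwS F n K h U₀) (QTwS F n K h U₀) ((0 : ℂ) • V) := by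
      rw [zero_smul, QTwS_def]; exact hd.hasFDerivAt
    have hg : HasDerivAt (fun t : ℂ => t • V) V 0 := by simpa using (hasDerivAt_id (0 : ℂ)).smul_const V
    have hc := hf.comp_hasDerivAt (0 : ℂ) hg
    exact hc
  have h2 : HasDerivAt (fun t : ℂ => t • Wv) Wv 0 := by simpa using (hasDerivAt_id (0 : ℂ)).smul_const Wv
  have h3 : HasDerivAt (fun t : ℂ => logChartTwS F n K h U₀ (t • V)) Wv 0 := h2.congr_of_eventuallyEq key
  exact h1.unique h3

/-- **(J2)-companion — on the scalar sector `Q(U₀)` takes ITS VALUE AT `U₀ = 1`**: `QTwS U₀ (c·1) = QTwS 1 (c·1)` (the straight `(K−n)`-fold tube average, ✓`QTwS_one_apply`),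
given the identity of `QTwS_apply_smul_one` (displayed as `hc`); the linear-map bookkeeping `Q_k(c·1) = (Q_k c)·1` is ✓`ChartHInv.bondAvgIter_comp_apply` at `z ↦ z·1`.
[cite: Balaban1984PropagatorsI, (1.18) p.20; Balaban1985Averaging, (125)-(127) p.36] -/
theorem QTwS_smul_one_eq_QTwS_one_of_central (U₀ : GaugeField (F.P K) 0 (Matrix.specialUnitaryGroup (Fin 2) ℂ)) (c : PBond (F.P K) 0 → ℂ)
    (hc : QTwS F n K h U₀ (fun b => c b • (1 : Matrix (Fin 2) (Fin 2) ℂ)) =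
      fun B => ((((F.P K).L : ℂ)) ^ (K - n) * bondAvgIter (K - n) c (bondShift (sites_eq F n K h) B)) • (1 : Matrix (Fin 2) (Fin 2) ℂ)) :
    QTwS F n K h U₀ (fun b => c b • (1 : Matrix (Fin 2) (Fin 2) ℂ)) = QTwS F n K h 1 (fun b => c b • (1 : Matrix (Fin 2) (Fin 2) ℂ)) := by
  rw [hc]
  funext B
  have h1 : bondAvgIter (K - n) (fun b => c b • (1 : Matrix (Fin 2) (Fin 2) ℂ)) (bondShift (sites_eq F n K h) B) =
      (bondAvgIter (K - n) c (bondShift (sites_eq F n K h) B)) • (1 : Matrix (Fin 2) (Fin 2) ℂ) :=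
    ChartHInv.bondAvgIter_comp_apply ((LinearMap.toSpanSingleton ℂ (Matrix (Fin 2) (Fin 2) ℂ) 1).restrictScalars ℝ) (K - n) c _
  rw [QTwS_one_apply, h1, smul_smul]

/-- **(G2)∕(G3) of memo #51 on the centre, algebraic half**: if `Q(c·1) = ℓ(c)·1` and `Q(c̄·1) = ℓ(c̄)·1` with the flat average `ℓ` (REAL coefficients: `ℓ(c̄) = \overline{ℓ(c)}`,
✓`ChartHInv.bondAvgIter_comp_apply` at complex conjugation), then `Q` commutes with the pointwise conjugate transpose on the scalar sector and maps it into the scalar sector.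
[cite: Balaban1984PropagatorsI, (1.18) p.20; Balaban1985Variational, (51) p.286] -/
theorem star_QTwS_smul_one_of_central (U₀ : GaugeField (F.P K) 0 (Matrix.specialUnitaryGroup (Fin 2) ℂ)) (c : PBond (F.P K) 0 → ℂ)
    (hc : QTwS F n K h U₀ (fun b => c b • (1 : Matrix (Fin 2) (Fin 2) ℂ)) =
      fun B => ((((F.P K).L : ℂ)) ^ (K - n) * bondAvgIter (K - n) c (bondShift (sites_eq F n K h) B)) • (1 : Matrix (Fin 2) (Fin 2) ℂ))
    (hcs : QTwS F n K h U₀ (fun b => (starRingEnd ℂ (c b)) • (1 : Matrix (Fin 2) (Fin 2) ℂ)) =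
      fun B => ((((F.P K).L : ℂ)) ^ (K - n) * bondAvgIter (K - n) (fun b => starRingEnd ℂ (c b)) (bondShift (sites_eq F n K h) B)) • (1 : Matrix (Fin 2) (Fin 2) ℂ)) :
    QTwS F n K h U₀ (star (fun b => c b • (1 : Matrix (Fin 2) (Fin 2) ℂ))) = star (QTwS F n K h U₀ (fun b => c b • (1 : Matrix (Fin 2) (Fin 2) ℂ))) := by
  have hstar : star (fun b => c b • (1 : Matrix (Fin 2) (Fin 2) ℂ)) = fun b => (starRingEnd ℂ (c b)) • (1 : Matrix (Fin 2) (Fin 2) ℂ) := by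
    funext b
    rw [Pi.star_apply, star_smul, star_one]
    rfl
  rw [hstar, hcs]
  funext B
  have hcB := congrFun hc B
  have hconj : bondAvgIter (K - n) (fun b => starRingEnd ℂ (c b)) (bondShift (sites_eq F n K h) B) =
      starRingEnd ℂ (bondAvgIter (K - n) c (bondShift (sites_eq F n K h) B)) :=
    ChartHInv.bondAvgIter_comp_apply (Complex.conjAe.toLinearMap.restrictScalars ℝ) (K - n) c _
  change _ = star (QTwS F n K h U₀ (fun b => c b • (1 : Matrix (Fin 2) (Fin 2) ℂ)) B)
  rw [hcB, hconj, Matrix.star_eq_conjTranspose, Matrix.conjTranspose_smul, Matrix.conjTranspose_one,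
    Complex.star_def, map_mul, map_pow, Complex.conj_natCast]

end Scalar

end Summit.QuantumFields.YangMills.Theorems.Prop7SymAvgTwSym

end
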